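import Summits.NavierStokesRegularity.NavierStokesRegularity.Theorems.StrainDoorsZoomMeasure
import HarnessLib

/-!
# Strain doors, PART M §M34 — DOOR Z: slices whose vorticity directions are ALIGNED to a reference direction
# OFF A SMALL EXCEPTIONAL SET are not singular (sup-norm Type-I class; reduced to the concentration door X)

Completion of the statement typed in ROUND 72 §4 of the `ns-regularity-ideate` p1 line (helper lane of
`stmt-NavierStokesRegularity-0056`, rung N0; nothing in this file is a claim about Navier–Stokes regularity, nor
about the tree's `NoTypeII`).  Barker–Prange's Theorem 3 (arXiv:1906.08225 p. 18) excludes a Type-I singularity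
when, along some sequence of times, the vorticity directions are uniformly continuous on the high-vorticity part
of a parabolic ball; the tree's ROUND-68/70 form (`SliceAlignedFixedDeltaNotSingular`) has a FIXED `δ₀(M,R)`.
DOOR Z localises the hypothesis in two ways the averaged (`L^∞`/`L^{3,∞}`) class cannot see: alignment to a
reference unit vector `e_n` is asked only OFF an arbitrary exceptional set `E_n` of measure `≤ κ(T − s_n)^{3/2}`
(a positive fraction of the parabolic ball) and only above the scale-critical level `|ω| > d/(T − s_n)`.
§M34(a) liminf of eventually-small sets (`measure_setOf_eventually_mem_le` / `_eq_zero`), a continuous function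
constant off a null set (`eq_on_open_of_eq_off_null`); §M34(b) the RIGIDITY in `𝓐_M`
(`sliceAlignedOffSmallSet_smallMass`: compactness (P2) + compact sphere, the liminf of the exceptional sets is
NULL, density, the one-slice Liouville theorems §M18); §M34(c) the door and its reduction to door X
(`sliceAlignedOffSmallSetNotSingular_of_sliceL3Concentration`: zoom `exists_zoomLimit_at_singular_along₆₈`,
rescaled exceptional sets through `volume_preimage_zoom`, scale invariance of `ξ`).  Closed forms: PART
`StrainDoorsDoorZClosed`.
-/

noncomputable section

set_option linter.dupNamespace false

open MeasureTheory Set Function Filter Metric Real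
open _root_.Topology
open scoped ENNReal NNReal
open Literature.Analysis Literature.Analysis.FluidPDE

namespace Summit.NavierStokesRegularity.NavierStokesRegularity.Theorems.StrainDoors

/-! ### §M34(a) Measure of a liminf of sets; a continuous function constant off a null set -/

/-- **The liminf of eventually-`κ`-small sets is `κ`-small** (monotone union of `⋂_{j ≥ N} E j`;
no measurability needed). [folklore] -/
theorem measure_setOf_eventually_mem_le {α : Type*} [MeasurableSpace α] {μ : Measure α}
    {E : ℕ → Set α} {κ : ℝ≥0∞} (h : ∀ᶠ j in atTop, μ (E j) ≤ κ) :
    μ {y | ∀ᶠ j in atTop, y ∈ E j} ≤ κ := by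
  obtain ⟨N₀, hN₀⟩ := eventually_atTop.1 h
  set B : ℕ → Set α := fun N => {y | ∀ j, N + N₀ ≤ j → y ∈ E j} with hBdef
  have hmono : Monotone B := fun N N' hNN' y hy j hj => hy j (by omega)
  have hsub : {y | ∀ᶠ j in atTop, y ∈ E j} ⊆ ⋃ N, B N := by
    intro y hy
    obtain ⟨N, hN⟩ := eventually_atTop.1 (mem_setOf_eq ▸ hy)
    rw [mem_iUnion]
    refine ⟨N, fun j hj => hN j ?_⟩
    omega
  have hBle : ∀ N, μ (B N) ≤ κ := fun N =>
    le_trans (measure_mono fun y hy => hy (N + N₀) le_rfl) (hN₀ (N + N₀) (by omega))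
  calc μ {y | ∀ᶠ j in atTop, y ∈ E j} ≤ μ (⋃ N, B N) := measure_mono hsub
    _ = ⨆ N, μ (B N) := hmono.measure_iUnion
    _ ≤ κ := iSup_le hBle

/-- **The liminf of asymptotically null sets is null.** [folklore] -/
theorem measure_setOf_eventually_mem_eq_zero {α : Type*} [MeasurableSpace α] {μ : Measure α}
    {E : ℕ → Set α} (h : ∀ ε : ℝ, 0 < ε → ∀ᶠ j in atTop, μ (E j) ≤ ENNReal.ofReal ε) :
    μ {y | ∀ᶠ j in atTop, y ∈ E j} = 0 := by
  refine le_antisymm (ENNReal.le_of_forall_pos_le_add fun ε hε _ => ?_) bot_le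
  rw [zero_add, ← ENNReal.ofReal_coe_nnreal]
  exact measure_setOf_eventually_mem_le (h ε (by exact_mod_cast hε))

/-- **A function continuous on an open set of `ℝ³` and constant off a Lebesgue-null set is constant on the
whole open set** (open balls have positive measure). [folklore] -/
theorem eq_on_open_of_eq_off_null {S B : Set (EuclideanSpace ℝ (Fin 3))} (hS : IsOpen S) (hB : volume B = 0)
    {f : EuclideanSpace ℝ (Fin 3) → EuclideanSpace ℝ (Fin 3)} {c : EuclideanSpace ℝ (Fin 3)}
    (hf : ∀ y ∈ S, ContinuousAt f y) (h : ∀ y ∈ S, y ∉ B → f y = c) : ∀ y ∈ S, f y = c := by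
  intro y hy
  by_contra hne
  have h1 : ∀ᶠ z in 𝓝 y, z ∈ S := hS.mem_nhds hy
  have h2 : ∀ᶠ z in 𝓝 y, f z ≠ c := (hf y hy).eventually_ne hne
  obtain ⟨ε, hε, hball⟩ := Metric.eventually_nhds_iff_ball.1 (h1.and h2)
  have hsubB : ball y ε ⊆ B := fun z hz => by_contra fun hzB => (hball z hz).2 (h z (hball z hz).1 hzB)
  exact (lt_irrefl (0 : ℝ≥0∞))
    ((measure_ball_pos volume y hε).trans_le ((measure_mono hsubB).trans hB.le))

/-! ### §M34(b) Rigidity in `A_M`: directions aligned to one unit vector off a small set ⇒ small mass -/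

/-- ★★★ **ONE-SLICE ALIGNMENT OFF A SMALL EXCEPTIONAL SET ⇒ SMALL MASS.**  For `M`, `R' > 0`, `R_m` and
`γ > 0` there are `δ, θ, κ > 0` (depending on these four numbers only) such that every `U ∈ 𝓐_M` for
which some unit vector `e` and some set `L` with `|L| ≤ κ` satisfy `|ξ_{U(−4)}(y) − e| ≤ δ` for every
`y ∈ B(0,R') ∖ L` with `|ω_U(−4)(y)| > θ`, has `∫_{B̄(0,R_m)} |U(−4,y)|³ dy < γ`.
Proof: otherwise `(δ_j, θ_j, κ_j) = 1/(j+1)` give `U_j ∈ 𝓐_M`, unit `e_j`, `κ_j`-small `L_j`, aligned, with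
mass `≥ γ`; by (P2) and compactness of the sphere a subsequence has `U_j → W ∈ 𝓐_M` pointwise with curls and
`e_j → e_∞`; the mass passes to the limit; the liminf set `B = {y | ∀ᶠ j, y ∈ L_j}` is NULL; off `B`, where
`ω_W(−4) ≠ 0`, `ξ_W = e_∞` (frequently-good indices + convergence of directions); by density and continuity
(`eq_on_open_of_eq_off_null`) `ω_W(−4) ∥ e_∞` on the open set `B(0,R') ∩ {ω_W(−4) ≠ 0}`, and §M18 gives
`W ≡ 0` (or, if that set is empty, the vanishing-curl form of §M18) — contradicting the mass.
[cite: GigaMiura2011, Thm 1.1/Lemma 3.1 (compactness–contradiction); BarkerPrange2020Alignment, §4 Step 3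
and Thm 3 (arXiv:1906.08225 pp. 16–18); ConstantinFefferman1993, §1] -/
theorem sliceAlignedOffSmallSet_smallMass (M : ℝ) {R' : ℝ} (hR' : 0 < R') (Rm : ℝ) {γ : ℝ} (hγ : 0 < γ) :
    ∃ δ θ κ : ℝ, 0 < δ ∧ 0 < θ ∧ 0 < κ ∧
      ∀ U : ℝ → EuclideanSpace ℝ (Fin 3) → EuclideanSpace ℝ (Fin 3), IsTypeIAncientMild M U →
        ∀ (e : EuclideanSpace ℝ (Fin 3)) (L : Set (EuclideanSpace ℝ (Fin 3))), ‖e‖ = 1 →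
          volume L ≤ ENNReal.ofReal κ →
          (∀ y ∈ ball (0 : EuclideanSpace ℝ (Fin 3)) R', y ∉ L → θ < ‖curl (U (-4)) y‖ →
            ‖vorticityDirection (curl (U (-4))) y - e‖ ≤ δ) →
          ∫ y in closedBall (0 : EuclideanSpace ℝ (Fin 3)) Rm, ‖U (-4) y‖ ^ 3 < γ := by
  by_contra hneg
  push Not at hneg
  have hF := fun j : ℕ =>
    hneg (1 / ((j : ℝ) + 1)) (1 / ((j : ℝ) + 1)) (1 / ((j : ℝ) + 1)) (by positivity) (by positivity)
      (by positivity)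
  choose U hUA e L he hL hcoh hmass using hF
  have h4 : (-4 : ℝ) < 0 := by norm_num
  -- (1) compactness (P2), then a convergent subsequence of the reference directions
  obtain ⟨W, φ, hφ, hW, hlim⟩ := typeIAncientCompactness_holds M U hUA
  have hsph : ∀ n, e (φ n) ∈ sphere (0 : EuclideanSpace ℝ (Fin 3)) 1 := fun n =>
    mem_sphere_zero_iff_norm.2 (he (φ n))
  obtain ⟨eI, heI, ψ, hψ, heψ⟩ := (isCompact_sphere (0 : EuclideanSpace ℝ (Fin 3)) 1).tendsto_subseq hsph
  have heI1 : ‖eI‖ = 1 := mem_sphere_zero_iff_norm.1 heI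
  have heI0 : eI ≠ 0 := by rw [← norm_ne_zero_iff, heI1]; norm_num
  have hge : ∀ i, i ≤ φ (ψ i) := fun i => (hψ.id_le i).trans (hφ.id_le _)
  have hlimU : ∀ y : EuclideanSpace ℝ (Fin 3),
      Tendsto (fun i => U (φ (ψ i)) (-4) y) atTop (𝓝 (W (-4) y)) := fun y =>
    ((hlim (-4) h4 y).1).comp hψ.tendsto_atTop
  have hlimC : ∀ y : EuclideanSpace ℝ (Fin 3),
      Tendsto (fun i => curl (U (φ (ψ i)) (-4)) y) atTop (𝓝 (curl (W (-4)) y)) := fun y =>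
    ((hlim (-4) h4 y).2).comp hψ.tendsto_atTop
  -- (2) the mass passes to the limit
  have hcU : ∀ j, Continuous (U j (-4)) := fun j => ((hUA j).contDiff_slice h4).continuous
  have hmassW : γ ≤ ∫ y in closedBall (0 : EuclideanSpace ℝ (Fin 3)) Rm, ‖W (-4) y‖ ^ 3 := by
    have hfin : IsFiniteMeasure (volume.restrict (closedBall (0 : EuclideanSpace ℝ (Fin 3)) Rm)) :=
      isFiniteMeasure_restrict.2 measure_closedBall_lt_top.ne
    have hT : Tendsto (fun i => ∫ y in closedBall (0 : EuclideanSpace ℝ (Fin 3)) Rm, ‖U (φ (ψ i)) (-4) y‖ ^ 3)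
        atTop (𝓝 (∫ y in closedBall (0 : EuclideanSpace ℝ (Fin 3)) Rm, ‖W (-4) y‖ ^ 3)) := by
      refine tendsto_integral_of_dominated_convergence (fun _ => (M / Real.sqrt (-(-4 : ℝ))) ^ 3)
        (fun i => ((hcU (φ (ψ i))).norm.pow 3).aestronglyMeasurable) (integrable_const _) ?_ ?_
      · intro i
        refine Eventually.of_forall fun y => ?_
        rw [Real.norm_of_nonneg (pow_nonneg (norm_nonneg _) 3)]
        exact pow_le_pow_left₀ (norm_nonneg _) ((hUA (φ (ψ i))).norm_le h4 y) 3
      · exact Eventually.of_forall fun y => ((hlimU y).norm).pow 3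
    exact ge_of_tendsto hT (Eventually.of_forall fun i => hmass (φ (ψ i)))
  -- (3) `W ≡ 0` is impossible
  have hWne : ¬ (∀ t : ℝ, t < 0 → ∀ x : EuclideanSpace ℝ (Fin 3), W t x = 0) := by
    intro hzero
    have hW0 : W (-4) = 0 := funext fun x => hzero _ h4 x
    have h0 : ∫ y in closedBall (0 : EuclideanSpace ℝ (Fin 3)) Rm, ‖W (-4) y‖ ^ 3 = 0 := by simp [hW0]
    linarith [hmassW]
  -- (4) the liminf of the exceptional sets is null
  set B : Set (EuclideanSpace ℝ (Fin 3)) := {y | ∀ᶠ i in atTop, y ∈ L (φ (ψ i))} with hBdef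
  have hBnull : volume B = 0 := by
    refine measure_setOf_eventually_mem_eq_zero fun ε hε => ?_
    have hev : ∀ᶠ i : ℕ in atTop, 1 / ((i : ℝ) + 1) ≤ ε :=
      (tendsto_one_div_add_atTop_nhds_zero_nat (𝕜 := ℝ)).eventually (Iic_mem_nhds hε)
    filter_upwards [hev] with i hi
    refine (hL (φ (ψ i))).trans (ENNReal.ofReal_le_ofReal (le_trans ?_ hi))
    exact one_div_le_one_div_of_le (by positivity) (by exact_mod_cast Nat.succ_le_succ (hge i))
  -- (5) off `B`, where `ω_W(−4) ≠ 0`, the direction of `W(−4)` is `eI`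
  have hcW : Continuous (curl (W (-4))) := by
    have h3 : ContDiff ℝ 1 (W (-4)) := (hW.contDiff_slice h4).of_le (by norm_cast)
    exact (contDiff_curl (n := 0) (by exact_mod_cast h3)).continuous
  have hTdir : ∀ y : EuclideanSpace ℝ (Fin 3), curl (W (-4)) y ≠ 0 →
      Tendsto (fun i => vorticityDirection (curl (U (φ (ψ i)) (-4))) y) atTop
        (𝓝 (vorticityDirection (curl (W (-4))) y)) := by
    intro y hy
    have h3 := (continuousAt_inv_norm_smul hy).tendsto.comp (hlimC y)
    simpa only [Function.comp_def, vorticityDirection_apply] using h3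
  have hdir : ∀ y ∈ ball (0 : EuclideanSpace ℝ (Fin 3)) R', y ∉ B → curl (W (-4)) y ≠ 0 →
      vorticityDirection (curl (W (-4))) y = eI := by
    intro y hy hyB hy0
    by_contra hne
    have hρ : 0 < ‖vorticityDirection (curl (W (-4))) y - eI‖ := norm_pos_iff.2 (sub_ne_zero.2 hne)
    have hfr : ∃ᶠ i in atTop, y ∉ L (φ (ψ i)) := Filter.not_eventually.1 hyB
    -- eventually above the thresholds `θ_i = 1/(φ(ψ i)+1)`
    have hhigh : ∀ᶠ i in atTop, 1 / ((φ (ψ i) : ℝ) + 1) < ‖curl (U (φ (ψ i)) (-4)) y‖ := by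
      have hc : 0 < ‖curl (W (-4)) y‖ := norm_pos_iff.2 hy0
      have h1 : ∀ᶠ i in atTop, ‖curl (W (-4)) y‖ / 2 < ‖curl (U (φ (ψ i)) (-4)) y‖ :=
        ((hlimC y).norm).eventually_const_lt (by linarith)
      have h2 : ∀ᶠ i : ℕ in atTop, 1 / ((i : ℝ) + 1) < ‖curl (W (-4)) y‖ / 2 :=
        (tendsto_one_div_add_atTop_nhds_zero_nat (𝕜 := ℝ)).eventually_lt_const (by linarith)
      filter_upwards [h1, h2] with i hi1 hi2
      refine lt_of_le_of_lt ?_ (hi2.trans hi1)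
      exact one_div_le_one_div_of_le (by positivity) (by exact_mod_cast Nat.succ_le_succ (hge i))
    -- eventually the directions are `ρ/2`-far from `e_i`
    have hfar : ∀ᶠ i in atTop, ‖vorticityDirection (curl (W (-4))) y - eI‖ / 2 <
        ‖vorticityDirection (curl (U (φ (ψ i)) (-4))) y - e (φ (ψ i))‖ :=
      (((hTdir y hy0).sub heψ).norm).eventually_const_lt (by linarith)
    have hsmallδ : ∀ᶠ i : ℕ in atTop, 1 / ((i : ℝ) + 1) < ‖vorticityDirection (curl (W (-4))) y - eI‖ / 2 :=
      (tendsto_one_div_add_atTop_nhds_zero_nat (𝕜 := ℝ)).eventually_lt_const (by linarith)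
    obtain ⟨i, hiL, hi1, hi2, hi3⟩ := (hfr.and_eventually (hhigh.and (hfar.and hsmallδ))).exists
    have hle := hcoh (φ (ψ i)) y hy hiL hi1
    have hδi : 1 / ((φ (ψ i) : ℝ) + 1) ≤ 1 / ((i : ℝ) + 1) :=
      one_div_le_one_div_of_le (by positivity) (by exact_mod_cast Nat.succ_le_succ (hge i))
    linarith
  -- (6) dichotomy at the slice `−4`
  by_cases hex : ∃ y₀ ∈ ball (0 : EuclideanSpace ℝ (Fin 3)) R', curl (W (-4)) y₀ ≠ 0
  · obtain ⟨y₀, hy₀, he0⟩ := hex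
    have hUo : IsOpen (ball (0 : EuclideanSpace ℝ (Fin 3)) R' ∩ {y | curl (W (-4)) y ≠ 0}) :=
      isOpen_ball.inter (isOpen_ne_fun hcW continuous_const)
    have h0U : y₀ ∈ ball (0 : EuclideanSpace ℝ (Fin 3)) R' ∩ {y | curl (W (-4)) y ≠ 0} := ⟨hy₀, he0⟩
    -- by density, the direction is `eI` on the WHOLE open set
    have hconst : ∀ y ∈ ball (0 : EuclideanSpace ℝ (Fin 3)) R' ∩ {y | curl (W (-4)) y ≠ 0},
        vorticityDirection (curl (W (-4))) y = eI := by
      refine eq_on_open_of_eq_off_null hUo hBnull (fun y hy => ?_) (fun y hy hyB => hdir y hy.1 hyB hy.2)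
      exact (continuousAt_inv_norm_smul hy.2).comp hcW.continuousAt
    -- `curl W(−4) ∥ eI` on the open set
    have hpar : ∀ y ∈ ball (0 : EuclideanSpace ℝ (Fin 3)) R' ∩ {y | curl (W (-4)) y ≠ 0},
        ∃ a : ℝ, curl (W (-4)) y = a • eI := by
      intro y hy
      have hy0 : curl (W (-4)) y ≠ 0 := hy.2
      have hξ := hconst y hy
      rw [vorticityDirection_apply] at hξ
      refine ⟨‖curl (W (-4)) y‖, ?_⟩
      calc curl (W (-4)) y
          = ‖curl (W (-4)) y‖ • (‖curl (W (-4)) y‖⁻¹ • curl (W (-4)) y) := by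
            rw [smul_smul, mul_inv_cancel₀ (norm_ne_zero_iff.2 hy0), one_smul]
        _ = ‖curl (W (-4)) y‖ • eI := by rw [hξ]
    exact hWne (eq_zero_of_typeIAncientMild_of_curl_parallel_on_open hW h4 hUo ⟨y₀, h0U⟩ heI0 hpar)
  · push Not at hex
    exact hWne (eq_zero_of_typeIAncientMild_of_curl_eq_zero_on_open hW h4 isOpen_ball
      ⟨0, mem_ball_self hR'⟩ hex)

/-! ### §M34(c) DOOR Z — slices aligned to a reference direction OFF A SMALL SET ⇒ regularity -/

/-- ★★ **DOOR Z (statement).**  For every `M` and `R > 0` there are `d, δ₀, κ > 0` (depending on `M, R` only)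
such that: if `(u,p)` is a classical solution of the unit-viscosity unforced Navier–Stokes system on
`ℝ³ × [0,T)`, Leray–Hopf on `[0,T)`, with the global Type-I bound `|u| ≤ M/√(T − t)` on `(0,T)`, and if along
SOME sequence of times `s_n → T` in `(0,T)` there are unit vectors `e_n` and EXCEPTIONAL SETS `E_n` of
measure `|E_n| ≤ κ (T − s_n)^{3/2}` such that `|ξ(x,s_n) − e_n| ≤ δ₀` at every `x ∈ B(x₀, R√(T − s_n)) ∖ E_n`
with SCALED vorticity `(T − s_n)|ω(x,s_n)| > d`, then `(T,x₀)` is NOT a singular point.  Compared with the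
tree's fixed-`δ₀` Barker–Prange criterion (`SliceAlignedFixedDeltaNotSingular`, ROUND 68/70: coherence at ALL
pairs of high-vorticity points), alignment is asked only OFF a set of positive scaled measure `κ` and only above
the scale-critical level `d/(T − s_n)`; contrapositive = an every-time DIRECTIONAL-DISORDER floor (PART
`StrainDoorsDoorZClosed`).  Informal sources: Barker–Prange 2020 (arXiv:1906.08225) Thm 3; Constantin–Fefferman
1993 §1; Grujić 2009 (localised coherence); Giga–Miura 2011 Thm 1.1. [new-as-typed] -/
def SliceAlignedOffSmallSetNotSingular : Prop :=
  ∀ M R : ℝ, 0 < R → ∃ d δ₀ κ : ℝ, 0 < d ∧ 0 < δ₀ ∧ 0 < κ ∧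
    ∀ (T : ℝ) (u : ℝ → EuclideanSpace ℝ (Fin 3) → EuclideanSpace ℝ (Fin 3))
      (p : ℝ → EuclideanSpace ℝ (Fin 3) → ℝ), 0 < T →
      IsClassicalNSSolutionOn (Ico 0 T) 1 0 u p → IsLerayHopfOn T 1 0 (u 0) u →
      (∀ t ∈ Ioo 0 T, ∀ x : EuclideanSpace ℝ (Fin 3), ‖u t x‖ ≤ M / Real.sqrt (T - t)) →
      ∀ (x₀ : EuclideanSpace ℝ (Fin 3)) (s : ℕ → ℝ) (e : ℕ → EuclideanSpace ℝ (Fin 3))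
        (E : ℕ → Set (EuclideanSpace ℝ (Fin 3))),
        (∀ n, s n ∈ Ioo 0 T) → Tendsto s atTop (𝓝 T) → (∀ n, ‖e n‖ = 1) →
        (∀ n, volume (E n) ≤ ENNReal.ofReal (κ * Real.sqrt (T - s n) ^ 3)) →
        (∀ n, ∀ x ∈ ball x₀ (R * Real.sqrt (T - s n)), x ∉ E n →
          d < (T - s n) * ‖curl (u (s n)) x‖ → ‖vorticityDirection (curl (u (s n))) x - e n‖ ≤ δ₀) →
        ¬ IsBackwardSingularPoint u (T, x₀)

/-- ★★★★ **DOOR Z, REDUCED TO THE CONCENTRATION DOOR X.**  `SliceL3Concentration → SliceAlignedOffSmallSetNotSingular`,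
with `(d, δ₀, κ) = (4θ, δ, κ'/8)` for the constants `(δ, θ, κ')` of `sliceAlignedOffSmallSet_smallMass` at
`(M, 2R, 2R_m(M), γ(M))`.  Proof: at a singular point, door X gives mass `≥ γ` on `B̄(x₀, R_m√(T − t))` for all
`t` near `T`; along a subsequence `e_n → e_∞` (compact sphere); zoom along its tail beyond the door-X time
(`exists_zoomLimit_at_singular_along₆₈`, `λ_j = √(T − s_j)/2`, slice `−4`): the zoomed slices converge with
their curls to `U(−4)`, `U ∈ 𝓐_M`, mass `≥ γ` on `B̄(0,2R_m)`; the rescaled exceptional sets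
`E'_j = (x₀ + λ_j ·)⁻¹ E_j` have `|E'_j| = λ_j⁻³|E_j| ≤ κ'` (`volume_preimage_zoom`), so their liminf `B` has
`|B| ≤ κ'`; for `y ∈ B(0,2R) ∖ B` with `|ω_U(−4)(y)| > θ` the pre-images are frequently outside `E_j` and
eventually above the scaled level `d`, and `ξ` of the zoomed slice at `y` (scale-invariant) tends to
`ξ_{U(−4)}(y)`, whence `|ξ_{U(−4)}(y) − e_∞| ≤ δ`; the rigidity gives mass `< γ` — contradiction.
[cite: BarkerPrange2020Alignment, Thm 3 and §4 Steps 1–3 (arXiv:1906.08225 pp. 16–18); BarkerPrange2020,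
Thm 2; GigaMiura2011, Thm 1.1; ConstantinFefferman1993, §1] -/
theorem sliceAlignedOffSmallSetNotSingular_of_sliceL3Concentration (hX : SliceL3Concentration) :
    SliceAlignedOffSmallSetNotSingular := by
  intro M R hR
  obtain ⟨γ, Rm, hγ, hRm, hXM⟩ := hX M
  have h2R : 0 < 2 * R := by positivity
  obtain ⟨δ, θ, κ, hδ, hθ, hκ, hsmall⟩ := sliceAlignedOffSmallSet_smallMass M h2R (2 * Rm) hγ
  refine ⟨4 * θ, δ, κ / 8, by positivity, hδ, by positivity, ?_⟩
  intro T u p hT hcl hLH hI x₀ s e E hs hsT he hE hcoh hsing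
  obtain ⟨t₁, ht₁, hmassX⟩ := hXM T u p hT hcl hLH hI x₀ hsing
  have hsph : ∀ n, e n ∈ sphere (0 : EuclideanSpace ℝ (Fin 3)) 1 := fun n => mem_sphere_zero_iff_norm.2 (he n)
  obtain ⟨eI, heI, ψ₀, hψ₀, heψ₀⟩ := (isCompact_sphere (0 : EuclideanSpace ℝ (Fin 3)) 1).tendsto_subseq hsph
  have heI1 : ‖eI‖ = 1 := mem_sphere_zero_iff_norm.1 heI
  -- (2) its tail beyond the door-X time `t₁`
  have hsT₀ : Tendsto (fun n => s (ψ₀ n)) atTop (𝓝 T) := hsT.comp hψ₀.tendsto_atTop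
  obtain ⟨N, hN⟩ := eventually_atTop.1 (hsT₀.eventually (Ioi_mem_nhds ht₁))
  set ι : ℕ → ℕ := fun n => ψ₀ (n + N) with hιdef
  set s' : ℕ → ℝ := fun n => s (ι n) with hs'def
  have hs' : ∀ n, s' n ∈ Ioo 0 T := fun n => hs _
  have hs'T : Tendsto s' atTop (𝓝 T) := hsT₀.comp (tendsto_add_atTop_nat N)
  have he' : Tendsto (fun n => e (ι n)) atTop (𝓝 eI) := heψ₀.comp (tendsto_add_atTop_nat N)
  have hmass' : ∀ n, γ ≤ ∫ y in closedBall x₀ (Rm * Real.sqrt (T - s' n)), ‖u (s' n) y‖ ^ 3 := fun n =>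
    hmassX (s' n) ⟨hN (n + N) (by omega), (hs' n).2⟩
  -- (3) zoom along `s'`
  obtain ⟨φ, hφ, U, hU, hvel, hcurl⟩ := exists_zoomLimit_at_singular_along₆₈ hT hcl hLH hI hsing hs' hs'T
  set lam : ℕ → ℝ := fun j => Real.sqrt (T - s' (φ j)) / 2 with hlamdef
  have hTs : ∀ j, 0 < T - s' (φ j) := fun j => by linarith [(hs' (φ j)).2]
  have hlam : ∀ j, 0 < lam j := fun j => by
    simp only [hlamdef]
    exact div_pos (Real.sqrt_pos.2 (hTs j)) two_pos
  have h4 : (-4 : ℝ) < 0 := by norm_num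
  have heφ : Tendsto (fun j => e (ι (φ j))) atTop (𝓝 eI) := he'.comp hφ.tendsto_atTop
  -- (4) the mass of the zoomed slices at `−4` and of the limit
  have hslice : ∀ j, Continuous (u (s' (φ j))) := by
    intro j
    have hc : ContinuousOn (uncurry u) (Ico 0 T ×ˢ univ) := hcl.smooth_velocity.continuousOn
    have h := hc.comp_continuous (continuous_const.prodMk continuous_id)
      (fun x : EuclideanSpace ℝ (Fin 3) => (⟨⟨(hs' (φ j)).1.le, (hs' (φ j)).2⟩, mem_univ x⟩ :
        (s' (φ j), x) ∈ Ico 0 T ×ˢ univ))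
    exact h
  have hzc : ∀ j, Continuous (fun y : EuclideanSpace ℝ (Fin 3) => lam j • u (s' (φ j)) (x₀ + lam j • y)) := by
    intro j
    have h1 : Continuous (fun y : EuclideanSpace ℝ (Fin 3) => x₀ + lam j • id y) :=
      continuous_const.add (continuous_id.const_smul (lam j))
    exact ((hslice j).comp h1).const_smul (lam j)
  have hzb : ∀ j (y : EuclideanSpace ℝ (Fin 3)), ‖lam j • u (s' (φ j)) (x₀ + lam j • y)‖ ≤ M / 2 := by
    intro j y
    have h := hI _ (hs' (φ j)) (x₀ + lam j • y)
    have hsq : 0 < Real.sqrt (T - s' (φ j)) := Real.sqrt_pos.2 (hTs j)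
    rw [le_div_iff₀ hsq] at h
    have e1 : lam j = Real.sqrt (T - s' (φ j)) / 2 := by simp only [hlamdef]
    rw [norm_smul, Real.norm_of_nonneg (hlam j).le]
    calc lam j * ‖u (s' (φ j)) (x₀ + lam j • y)‖
        = ‖u (s' (φ j)) (x₀ + lam j • y)‖ * Real.sqrt (T - s' (φ j)) / 2 := by rw [e1]; ring
      _ ≤ M / 2 := by gcongr
  have hzmass : ∀ j, γ ≤ ∫ y in closedBall (0 : EuclideanSpace ℝ (Fin 3)) (2 * Rm),
      ‖lam j • u (s' (φ j)) (x₀ + lam j • y)‖ ^ 3 := by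
    intro j
    rw [setIntegral_norm_zoom_pow_three (u (s' (φ j))) x₀ (hlam j) (by positivity)]
    have e1 : lam j * (2 * Rm) = Rm * Real.sqrt (T - s' (φ j)) := by simp only [hlamdef]; ring
    rw [e1]
    exact hmass' (φ j)
  have hmassU : γ ≤ ∫ y in closedBall (0 : EuclideanSpace ℝ (Fin 3)) (2 * Rm), ‖U (-4) y‖ ^ 3 := by
    have hfin : IsFiniteMeasure (volume.restrict (closedBall (0 : EuclideanSpace ℝ (Fin 3)) (2 * Rm))) :=
      isFiniteMeasure_restrict.2 measure_closedBall_lt_top.ne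
    have hT' : Tendsto (fun j => ∫ y in closedBall (0 : EuclideanSpace ℝ (Fin 3)) (2 * Rm),
        ‖lam j • u (s' (φ j)) (x₀ + lam j • y)‖ ^ 3)
        atTop (𝓝 (∫ y in closedBall (0 : EuclideanSpace ℝ (Fin 3)) (2 * Rm), ‖U (-4) y‖ ^ 3)) := by
      refine tendsto_integral_of_dominated_convergence (fun _ => (M / 2) ^ 3)
        (fun j => ((hzc j).norm.pow 3).aestronglyMeasurable) (integrable_const _) ?_ ?_
      · intro j
        refine Eventually.of_forall fun y => ?_
        rw [Real.norm_of_nonneg (pow_nonneg (norm_nonneg _) 3)]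
        exact pow_le_pow_left₀ (norm_nonneg _) (hzb j y) 3
      · exact Eventually.of_forall fun y => ((hvel y).norm).pow 3
    exact ge_of_tendsto hT' (Eventually.of_forall hzmass)
  -- (5) the rescaled exceptional sets and their liminf
  set E' : ℕ → Set (EuclideanSpace ℝ (Fin 3)) := fun j => (fun y => x₀ + lam j • y) ⁻¹' E (ι (φ j)) with hE'def
  have hE'vol : ∀ j, volume (E' j) ≤ ENNReal.ofReal κ := by
    intro j
    have h1 := volume_preimage_zoom x₀ (hlam j) (E (ι (φ j)))
    have hsq : Real.sqrt (T - s' (φ j)) = 2 * lam j := by simp only [hlamdef]; ring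
    have h2 : volume (E (ι (φ j))) ≤ ENNReal.ofReal (κ / 8 * (2 * lam j) ^ 3) := by
      rw [← hsq]
      exact hE (ι (φ j))
    have h3 : (lam j ^ 3)⁻¹ * (κ / 8 * (2 * lam j) ^ 3) = κ := by
      have hl0 : lam j ≠ 0 := (hlam j).ne'
      field_simp
      ring
    calc volume (E' j) = ENNReal.ofReal ((lam j ^ 3)⁻¹) * volume (E (ι (φ j))) := h1
      _ ≤ ENNReal.ofReal ((lam j ^ 3)⁻¹) * ENNReal.ofReal (κ / 8 * (2 * lam j) ^ 3) := by gcongr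
      _ = ENNReal.ofReal κ := by
          rw [← ENNReal.ofReal_mul (inv_nonneg.2 (pow_nonneg (hlam j).le 3)), h3]
  set B : Set (EuclideanSpace ℝ (Fin 3)) := {y | ∀ᶠ j in atTop, y ∈ E' j} with hBdef
  have hB : volume B ≤ ENNReal.ofReal κ := measure_setOf_eventually_mem_le (Eventually.of_forall hE'vol)
  -- (6) the alignment passes to `U(−4)` on `B(0,2R)` off `B` above the level `θ`
  have hcohU : ∀ y ∈ ball (0 : EuclideanSpace ℝ (Fin 3)) (2 * R), y ∉ B → θ < ‖curl (U (-4)) y‖ →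
      ‖vorticityDirection (curl (U (-4))) y - eI‖ ≤ δ := by
    intro y hy hyB hθy
    have hy0 : curl (U (-4)) y ≠ 0 := norm_pos_iff.1 (hθ.trans hθy)
    have hfr : ∃ᶠ j in atTop, y ∉ E' j := Filter.not_eventually.1 hyB
    -- the pre-images lie in the balls `B(x₀, R√(T − s'))`
    have hmem : ∀ j, x₀ + lam j • y ∈ ball x₀ (R * Real.sqrt (T - s' (φ j))) := by
      intro j
      rw [mem_ball, dist_eq_norm, add_sub_cancel_left, norm_smul, Real.norm_of_nonneg (hlam j).le, hlamdef]
      dsimp only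
      have hw' : ‖y‖ < 2 * R := mem_ball_zero_iff.1 hy
      have hsq : 0 < Real.sqrt (T - s' (φ j)) := Real.sqrt_pos.2 (hTs j)
      nlinarith
    -- eventually above the scaled level `4θ`
    have hhigh : ∀ᶠ j in atTop, 4 * θ < (T - s' (φ j)) * ‖curl (u (s' (φ j))) (x₀ + lam j • y)‖ := by
      have h1 : ∀ᶠ j in atTop, θ < ‖((T - s' (φ j)) / 4) • curl (u (s' (φ j))) (x₀ + lam j • y)‖ :=
        ((hcurl y).norm).eventually_const_lt hθy
      filter_upwards [h1] with j hj
      have hq : 0 ≤ (T - s' (φ j)) / 4 := by linarith [hTs j]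
      rw [norm_smul, Real.norm_of_nonneg hq] at hj
      linarith
    -- the directions of the zoomed slices at `y` converge to `ξ_{U(−4)}(y)`
    have hTdir : Tendsto (fun j => vorticityDirection (curl (u (s' (φ j)))) (x₀ + lam j • y)) atTop
        (𝓝 (vorticityDirection (curl (U (-4))) y)) := by
      have h1 := (continuousAt_inv_norm_smul hy0).tendsto.comp (hcurl y)
      refine (by simpa only [Function.comp_def, vorticityDirection_apply] using h1 :
        Tendsto (fun j => ‖((T - s' (φ j)) / 4) • curl (u (s' (φ j))) (x₀ + lam j • y)‖⁻¹ •
          (((T - s' (φ j)) / 4) • curl (u (s' (φ j))) (x₀ + lam j • y))) atTop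
          (𝓝 (vorticityDirection (curl (U (-4))) y))).congr fun j => ?_
      have hq : 0 < (T - s' (φ j)) / 4 := by linarith [hTs j]
      rw [← vorticityDirection_const_smul hq (ω := curl (u (s' (φ j))))]
      rfl
    by_contra hgt
    push Not at hgt
    have hfar : ∀ᶠ j in atTop, δ < ‖vorticityDirection (curl (u (s' (φ j)))) (x₀ + lam j • y) - e (ι (φ j))‖ :=
      ((hTdir.sub heφ).norm).eventually_const_lt hgt
    obtain ⟨j, hjE, hjhigh, hjfar⟩ := (hfr.and_eventually (hhigh.and hfar)).exists
    have hle : ‖vorticityDirection (curl (u (s' (φ j)))) (x₀ + lam j • y) - e (ι (φ j))‖ ≤ δ :=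
      hcoh (ι (φ j)) _ (hmem j) hjE hjhigh
    linarith
  linarith [hsmall U hU eI B heI1 hB hcohU]

end Summit.NavierStokesRegularity.NavierStokesRegularity.Theorems.StrainDoors

end
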